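import Summits.MatrixMultiplication.MatrixMultiplication.Theorems.ObstructionDescentCountingEquations
import Summits.MatrixMultiplication.MatrixMultiplication.Theses.ObstructionDescent

/-!
# Poly-degree slices: given `E`, occurrence- and multiplicity-blindness hold in every polynomial degree
(decomp-mm · lens 3 · gen 18, second kernel)

Route `route-MatrixMultiplication-ObstructionDescent` (`ω(ℂ) = 2`).  The degree axis `E = NoPolyDegreeObstruction`
(item 30889) is TYPE-FREE: every polynomial of degree `≤ m^c` vanishing on `GL_m³·⟨m⟩` vanishes on `GL_m³·pad_m⟨n,n,n⟩`.
The information axis — `P_O = NoOccurrenceObstruction` (crux 29040), `P_M = NoMultiplicityObstruction` (29041, the target of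
`L = OccurrenceLifts` 29042 and the `P_M`-half of the residual `B = JointBlindnessDecides` 30890) — is stated TYPE BY TYPE
over the weight spaces `W(Λ, d)` of homogeneous degree `d`.  This module records the factorisation through the degree
filtration:

* `occurrenceSlice_of_noPolyDegreeObstruction`, `multiplicitySlice_of_noPolyDegreeObstruction`: `E` implies, for every
  exponent `c`, the rows `d ≤ m^c` of `P_O` and of `P_M` — indeed for EVERY set `W` of degree-`d` forms (not only weight
  spaces): containment `W ∩ I(GL³⟨m⟩) ⊆ W ∩ I(GL³ pad)` and hence domination of the spanned dimensions (the larger span is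
  finite-dimensional: it sits in the polynomials of degree `≤ d`, `ObstructionDescentCountingEquations.finrank_restrictTotalDegree_le`).
* `noOccurrenceObstruction_rows_of_E`, `noMultiplicityObstruction_rows_of_E`: the same in the verbatim binder shape of the
  route items (the type `Λ` and the semi-invariance clause are carried, unused).

Reading for the cut (no item changes): given `E`, the cruxes `P_O` (29040) and `L` (29042) and the `P_M`-half of the residual
`B` (30890) are load-bearing only in degrees `d` exceeding every polynomial in `m` along the offending cells — a counterexample
to `L` in the presence of `E` is a weight space of super-polynomial degree where occurrence holds and multiplicity domination
fails.  Companion: `ObstructionDescentCountingEquations.rows_contentful` (the rows `c ≥ 3` of `E` are themselves non-vacuous).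
No proposition is defined; sorry-free; standard axioms.  Nothing here proves `ω = 2`.
[cite: BurgisserIkenmeyer2011, §3.1 + Thm. 4.6 (arXiv:1011.1350 p. 6); KumarVolk2022, Theorem 10 (arXiv:2003.12938 p. 7)]
-/

set_option linter.dupNamespace false
set_option autoImplicit false

noncomputable section

open scoped BigOperators

namespace Summit.MatrixMultiplication.MatrixMultiplication.Theorems.ObstructionDescentPolyDegreeSlices

open Literature.Computability.AlgebraicComplexity (actTensor unitTensor matMulTensor)
open Summit.MatrixMultiplication.MatrixMultiplication.Theses.ObstructionDescent (NoPolyDegreeObstruction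
  NoMultiplicityObstruction NoOccurrenceObstruction)
open Summit.MatrixMultiplication.MatrixMultiplication.Theorems.ObstructionDescentCountingEquations
  (finrank_restrictTotalDegree_le)

/-! ## §1 Type-free slices -/

/-- **`E` ⟹ the polynomial-degree rows of occurrence-blindness, for every set of degree-`d` forms**: at the cells of
`E(c)`, if `d ≤ m^c` and every `f ∈ W ⊆ S^d` vanishes on `GL_m³·⟨m⟩`, then every `f ∈ W` vanishes on `GL_m³·pad_m⟨n,n,n⟩`.
[cite: BurgisserIkenmeyer2011, §3.1 (S(pad) ⊆ S(unit) degree-wise)] -/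
theorem occurrenceSlice_of_noPolyDegreeObstruction (hE : NoPolyDegreeObstruction) (c : ℕ) (τ : ℝ) (hτ : 2 < τ) :
    ∃ n₀ : ℕ, ∀ n m : ℕ, n₀ ≤ n → ∀ h : n * n ≤ m, (n : ℝ) ^ τ ≤ (m : ℝ) →
      ∀ (d : ℕ) (W : Set (MvPolynomial (Fin m × Fin m × Fin m) ℂ)), W ⊆ {f | f.IsHomogeneous d} → d ≤ m ^ c →
        (∀ f ∈ W, ∀ A B C : Matrix (Fin m) (Fin m) ℂ, A.det ≠ 0 → B.det ≠ 0 → C.det ≠ 0 →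
          MvPolynomial.aeval (fun p : Fin m × Fin m × Fin m => actTensor A B C (unitTensor ℂ m) p.1 p.2.1 p.2.2) f = 0) →
        ∀ f ∈ W, ∀ A B C : Matrix (Fin m) (Fin m) ℂ, A.det ≠ 0 → B.det ≠ 0 → C.det ≠ 0 →
          MvPolynomial.aeval (fun p : Fin m × Fin m × Fin m => actTensor A B C
            ((fun a b c : Fin m => ∑ r : (Fin n × Fin n) × (Fin n × Fin n) × (Fin n × Fin n),
              (if Fin.castLE h (finProdFinEquiv r.1) = a ∧ Fin.castLE h (finProdFinEquiv r.2.1) = b ∧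
                Fin.castLE h (finProdFinEquiv r.2.2) = c then (1 : ℂ) else 0) * matMulTensor ℂ n n n r.1 r.2.1 r.2.2))
            p.1 p.2.1 p.2.2) f = 0 := by
  obtain ⟨n₀, hn₀⟩ := hE c τ hτ
  refine ⟨n₀, fun n m hn h hτm d W hW hd hU f hf => ?_⟩
  have hhom : f.IsHomogeneous d := hW hf
  exact hn₀ n m hn h hτm f (hhom.totalDegree_le.trans hd) (hU f hf)

/-- **`E` ⟹ the polynomial-degree rows of multiplicity-blindness, for every set of degree-`d` forms**: at the cells of
`E(c)`, if `d ≤ m^c` and `W ⊆ S^d` then `dim span(W ∩ I(GL_m³·⟨m⟩)) ≤ dim span(W ∩ I(GL_m³·pad_m⟨n,n,n⟩))` — by containment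
of the two sets; the larger span lies in the finite-dimensional space of polynomials of degree `≤ d`.
[cite: BurgisserIkenmeyer2011, Thm. 4.6 (arXiv p. 6); KumarVolk2022, Theorem 10 (arXiv p. 7)] -/
theorem multiplicitySlice_of_noPolyDegreeObstruction (hE : NoPolyDegreeObstruction) (c : ℕ) (τ : ℝ) (hτ : 2 < τ) :
    ∃ n₀ : ℕ, ∀ n m : ℕ, n₀ ≤ n → ∀ h : n * n ≤ m, (n : ℝ) ^ τ ≤ (m : ℝ) →
      ∀ (d : ℕ) (W : Set (MvPolynomial (Fin m × Fin m × Fin m) ℂ)), W ⊆ {f | f.IsHomogeneous d} → d ≤ m ^ c →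
        Module.finrank ℂ ↥(Submodule.span ℂ (W ∩ {f | ∀ A B C : Matrix (Fin m) (Fin m) ℂ, A.det ≠ 0 → B.det ≠ 0 →
          C.det ≠ 0 → MvPolynomial.aeval (fun p : Fin m × Fin m × Fin m =>
            actTensor A B C (unitTensor ℂ m) p.1 p.2.1 p.2.2) f = 0})) ≤
        Module.finrank ℂ ↥(Submodule.span ℂ (W ∩ {f | ∀ A B C : Matrix (Fin m) (Fin m) ℂ, A.det ≠ 0 → B.det ≠ 0 →
          C.det ≠ 0 → MvPolynomial.aeval (fun p : Fin m × Fin m × Fin m => actTensor A B C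
            ((fun a b c : Fin m => ∑ r : (Fin n × Fin n) × (Fin n × Fin n) × (Fin n × Fin n),
              (if Fin.castLE h (finProdFinEquiv r.1) = a ∧ Fin.castLE h (finProdFinEquiv r.2.1) = b ∧
                Fin.castLE h (finProdFinEquiv r.2.2) = c then (1 : ℂ) else 0) * matMulTensor ℂ n n n r.1 r.2.1 r.2.2))
            p.1 p.2.1 p.2.2) f = 0})) := by
  obtain ⟨n₀, hn₀⟩ := occurrenceSlice_of_noPolyDegreeObstruction hE c τ hτ
  refine ⟨n₀, fun n m hn h hτm d W hW hd => ?_⟩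
  -- containment of the two sets, from the occurrence slice applied to the singletons `{f}`
  have hsub : (W ∩ {f | ∀ A B C : Matrix (Fin m) (Fin m) ℂ, A.det ≠ 0 → B.det ≠ 0 → C.det ≠ 0 →
      MvPolynomial.aeval (fun p : Fin m × Fin m × Fin m => actTensor A B C (unitTensor ℂ m) p.1 p.2.1 p.2.2) f = 0}) ⊆
      (W ∩ {f | ∀ A B C : Matrix (Fin m) (Fin m) ℂ, A.det ≠ 0 → B.det ≠ 0 → C.det ≠ 0 →
        MvPolynomial.aeval (fun p : Fin m × Fin m × Fin m => actTensor A B C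
          ((fun a b c : Fin m => ∑ r : (Fin n × Fin n) × (Fin n × Fin n) × (Fin n × Fin n),
            (if Fin.castLE h (finProdFinEquiv r.1) = a ∧ Fin.castLE h (finProdFinEquiv r.2.1) = b ∧
              Fin.castLE h (finProdFinEquiv r.2.2) = c then (1 : ℂ) else 0) * matMulTensor ℂ n n n r.1 r.2.1 r.2.2))
          p.1 p.2.1 p.2.2) f = 0}) := by
    rintro f ⟨hfW, hfU⟩
    refine ⟨hfW, ?_⟩
    have := hn₀ n m hn h hτm d {f} (fun g hg => by rw [Set.mem_singleton_iff.1 hg]; exact hW hfW) hd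
      (fun g hg => by rw [Set.mem_singleton_iff.1 hg]; exact hfU) f (Set.mem_singleton f)
    exact this
  -- the larger span is finite-dimensional
  have hT : Submodule.span ℂ (W ∩ {f | ∀ A B C : Matrix (Fin m) (Fin m) ℂ, A.det ≠ 0 → B.det ≠ 0 → C.det ≠ 0 →
        MvPolynomial.aeval (fun p : Fin m × Fin m × Fin m => actTensor A B C
          ((fun a b c : Fin m => ∑ r : (Fin n × Fin n) × (Fin n × Fin n) × (Fin n × Fin n),
            (if Fin.castLE h (finProdFinEquiv r.1) = a ∧ Fin.castLE h (finProdFinEquiv r.2.1) = b ∧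
              Fin.castLE h (finProdFinEquiv r.2.2) = c then (1 : ℂ) else 0) * matMulTensor ℂ n n n r.1 r.2.1 r.2.2))
          p.1 p.2.1 p.2.2) f = 0}) ≤ MvPolynomial.restrictTotalDegree (Fin m × Fin m × Fin m) ℂ d := by
    refine Submodule.span_le.2 fun f hf => ?_
    have hhom : f.IsHomogeneous d := hW hf.1
    change f ∈ MvPolynomial.restrictTotalDegree (Fin m × Fin m × Fin m) ℂ d
    rw [MvPolynomial.mem_restrictTotalDegree]
    exact hhom.totalDegree_le
  haveI := (finrank_restrictTotalDegree_le (Fin m × Fin m × Fin m) d).1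
  haveI := Submodule.finiteDimensional_of_le hT
  exact Submodule.finrank_mono (Submodule.span_mono hsub)

/-! ## §2 The rows of the route items, verbatim binders -/

/-- **`E` ⟹ every polynomial-degree row of `P_O = NoOccurrenceObstruction`** (verbatim binder shape of item 29040 with the
extra hypothesis `d ≤ m^c`; the type `Λ` and the Borel semi-invariance clause are carried, not used). Given `E`, the crux
`P_O` is load-bearing only in degrees exceeding every polynomial in `m`. [cite: BurgisserIkenmeyer2011, §3.1] -/
theorem noOccurrenceObstruction_rows_of_E (hE : NoPolyDegreeObstruction) (c : ℕ) :
    ∀ τ : ℝ, 2 < τ → ∃ n₀ : ℕ, ∀ n m : ℕ, n₀ ≤ n → ∀ h : n * n ≤ m, (n : ℝ) ^ τ ≤ (m : ℝ) →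
      ∀ (Λ : Fin 3 → Fin m → ℕ) (d : ℕ) (W : Set (MvPolynomial (Fin m × Fin m × Fin m) ℂ)),
        W = {f | f.IsHomogeneous d ∧ ∀ A B C : Matrix (Fin m) (Fin m) ℂ,
          ((∀ i j : Fin m, j < i → A i j = 0) ∧ ∀ i : Fin m, A i i ≠ 0) →
          ((∀ i j : Fin m, j < i → B i j = 0) ∧ ∀ i : Fin m, B i i ≠ 0) →
          ((∀ i j : Fin m, j < i → C i j = 0) ∧ ∀ i : Fin m, C i i ≠ 0) → ∀ t : Fin m → Fin m → Fin m → ℂ,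
            MvPolynomial.aeval (fun p : Fin m × Fin m × Fin m => actTensor A B C t p.1 p.2.1 p.2.2) f =
              (∏ i, A i i ^ Λ 0 i) * (∏ i, B i i ^ Λ 1 i) * (∏ i, C i i ^ Λ 2 i) *
                MvPolynomial.aeval (fun p : Fin m × Fin m × Fin m => t p.1 p.2.1 p.2.2) f} →
        d ≤ m ^ c →
        (∀ f ∈ W, ∀ A B C : Matrix (Fin m) (Fin m) ℂ, A.det ≠ 0 → B.det ≠ 0 → C.det ≠ 0 →
          MvPolynomial.aeval (fun p : Fin m × Fin m × Fin m => actTensor A B C (unitTensor ℂ m) p.1 p.2.1 p.2.2) f = 0) →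
        ∀ f ∈ W, ∀ A B C : Matrix (Fin m) (Fin m) ℂ, A.det ≠ 0 → B.det ≠ 0 → C.det ≠ 0 →
          MvPolynomial.aeval (fun p : Fin m × Fin m × Fin m => actTensor A B C
            ((fun a b c : Fin m => ∑ r : (Fin n × Fin n) × (Fin n × Fin n) × (Fin n × Fin n),
              (if Fin.castLE h (finProdFinEquiv r.1) = a ∧ Fin.castLE h (finProdFinEquiv r.2.1) = b ∧
                Fin.castLE h (finProdFinEquiv r.2.2) = c then (1 : ℂ) else 0) * matMulTensor ℂ n n n r.1 r.2.1 r.2.2))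
            p.1 p.2.1 p.2.2) f = 0 := by
  intro τ hτ
  obtain ⟨n₀, hn₀⟩ := occurrenceSlice_of_noPolyDegreeObstruction hE c τ hτ
  refine ⟨n₀, fun n m hn h hτm Λ d W hW hd => hn₀ n m hn h hτm d W ?_ hd⟩
  intro f hf
  rw [hW] at hf
  exact hf.1

/-- **`E` ⟹ every polynomial-degree row of `P_M = NoMultiplicityObstruction`** (verbatim binder shape of item 29041 with the
extra hypothesis `d ≤ m^c`). Given `E`, the item `P_M` — target of the crux `L = OccurrenceLifts` (29042) and the `P_M`-half
of the residual `B = JointBlindnessDecides` (30890) — is load-bearing only in degrees exceeding every polynomial in `m`.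
[cite: BurgisserIkenmeyer2011, Thm. 4.6 (arXiv:1011.1350 p. 6)] -/
theorem noMultiplicityObstruction_rows_of_E (hE : NoPolyDegreeObstruction) (c : ℕ) :
    ∀ τ : ℝ, 2 < τ → ∃ n₀ : ℕ, ∀ n m : ℕ, n₀ ≤ n → ∀ h : n * n ≤ m, (n : ℝ) ^ τ ≤ (m : ℝ) →
      ∀ (Λ : Fin 3 → Fin m → ℕ) (d : ℕ) (W : Set (MvPolynomial (Fin m × Fin m × Fin m) ℂ)),
        W = {f | f.IsHomogeneous d ∧ ∀ A B C : Matrix (Fin m) (Fin m) ℂ,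
          ((∀ i j : Fin m, j < i → A i j = 0) ∧ ∀ i : Fin m, A i i ≠ 0) →
          ((∀ i j : Fin m, j < i → B i j = 0) ∧ ∀ i : Fin m, B i i ≠ 0) →
          ((∀ i j : Fin m, j < i → C i j = 0) ∧ ∀ i : Fin m, C i i ≠ 0) → ∀ t : Fin m → Fin m → Fin m → ℂ,
            MvPolynomial.aeval (fun p : Fin m × Fin m × Fin m => actTensor A B C t p.1 p.2.1 p.2.2) f =
              (∏ i, A i i ^ Λ 0 i) * (∏ i, B i i ^ Λ 1 i) * (∏ i, C i i ^ Λ 2 i) *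
                MvPolynomial.aeval (fun p : Fin m × Fin m × Fin m => t p.1 p.2.1 p.2.2) f} →
        d ≤ m ^ c →
        Module.finrank ℂ ↥(Submodule.span ℂ (W ∩ {f | ∀ A B C : Matrix (Fin m) (Fin m) ℂ, A.det ≠ 0 → B.det ≠ 0 →
          C.det ≠ 0 → MvPolynomial.aeval (fun p : Fin m × Fin m × Fin m =>
            actTensor A B C (unitTensor ℂ m) p.1 p.2.1 p.2.2) f = 0})) ≤
        Module.finrank ℂ ↥(Submodule.span ℂ (W ∩ {f | ∀ A B C : Matrix (Fin m) (Fin m) ℂ, A.det ≠ 0 → B.det ≠ 0 →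
          C.det ≠ 0 → MvPolynomial.aeval (fun p : Fin m × Fin m × Fin m => actTensor A B C
            ((fun a b c : Fin m => ∑ r : (Fin n × Fin n) × (Fin n × Fin n) × (Fin n × Fin n),
              (if Fin.castLE h (finProdFinEquiv r.1) = a ∧ Fin.castLE h (finProdFinEquiv r.2.1) = b ∧
                Fin.castLE h (finProdFinEquiv r.2.2) = c then (1 : ℂ) else 0) * matMulTensor ℂ n n n r.1 r.2.1 r.2.2))
            p.1 p.2.1 p.2.2) f = 0})) := by
  intro τ hτ
  obtain ⟨n₀, hn₀⟩ := multiplicitySlice_of_noPolyDegreeObstruction hE c τ hτ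
  refine ⟨n₀, fun n m hn h hτm Λ d W hW hd => hn₀ n m hn h hτm d W ?_ hd⟩
  intro f hf
  rw [hW] at hf
  exact hf.1

/-! ## §3 Sanity link: the verbatim rows specialise the items -/

/-- `P_M` itself implies each of its polynomial-degree rows (so the rows are genuine weakenings of the item, implied both by
`P_M` and — §2 — by `E`). [bookkeeping] -/
theorem noMultiplicityObstruction_rows_of_P_M (hM : NoMultiplicityObstruction) (c : ℕ) :
    ∀ τ : ℝ, 2 < τ → ∃ n₀ : ℕ, ∀ n m : ℕ, n₀ ≤ n → ∀ h : n * n ≤ m, (n : ℝ) ^ τ ≤ (m : ℝ) →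
      ∀ (Λ : Fin 3 → Fin m → ℕ) (d : ℕ) (W : Set (MvPolynomial (Fin m × Fin m × Fin m) ℂ)),
        W = {f | f.IsHomogeneous d ∧ ∀ A B C : Matrix (Fin m) (Fin m) ℂ,
          ((∀ i j : Fin m, j < i → A i j = 0) ∧ ∀ i : Fin m, A i i ≠ 0) →
          ((∀ i j : Fin m, j < i → B i j = 0) ∧ ∀ i : Fin m, B i i ≠ 0) →
          ((∀ i j : Fin m, j < i → C i j = 0) ∧ ∀ i : Fin m, C i i ≠ 0) → ∀ t : Fin m → Fin m → Fin m → ℂ,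
            MvPolynomial.aeval (fun p : Fin m × Fin m × Fin m => actTensor A B C t p.1 p.2.1 p.2.2) f =
              (∏ i, A i i ^ Λ 0 i) * (∏ i, B i i ^ Λ 1 i) * (∏ i, C i i ^ Λ 2 i) *
                MvPolynomial.aeval (fun p : Fin m × Fin m × Fin m => t p.1 p.2.1 p.2.2) f} →
        d ≤ m ^ c →
        Module.finrank ℂ ↥(Submodule.span ℂ (W ∩ {f | ∀ A B C : Matrix (Fin m) (Fin m) ℂ, A.det ≠ 0 → B.det ≠ 0 →
          C.det ≠ 0 → MvPolynomial.aeval (fun p : Fin m × Fin m × Fin m =>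
            actTensor A B C (unitTensor ℂ m) p.1 p.2.1 p.2.2) f = 0})) ≤
        Module.finrank ℂ ↥(Submodule.span ℂ (W ∩ {f | ∀ A B C : Matrix (Fin m) (Fin m) ℂ, A.det ≠ 0 → B.det ≠ 0 →
          C.det ≠ 0 → MvPolynomial.aeval (fun p : Fin m × Fin m × Fin m => actTensor A B C
            ((fun a b c : Fin m => ∑ r : (Fin n × Fin n) × (Fin n × Fin n) × (Fin n × Fin n),
              (if Fin.castLE h (finProdFinEquiv r.1) = a ∧ Fin.castLE h (finProdFinEquiv r.2.1) = b ∧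
                Fin.castLE h (finProdFinEquiv r.2.2) = c then (1 : ℂ) else 0) * matMulTensor ℂ n n n r.1 r.2.1 r.2.2))
            p.1 p.2.1 p.2.2) f = 0})) := by
  intro τ hτ
  obtain ⟨n₀, hn₀⟩ := hM τ hτ
  exact ⟨n₀, fun n m hn h hτm Λ d W hW _ => hn₀ n m hn h hτm Λ d W hW⟩

end Summit.MatrixMultiplication.MatrixMultiplication.Theorems.ObstructionDescentPolyDegreeSlices

end
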